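import Literature.Analysis.FluidPDE.CylindricalGenerator
import Summits.AnomalousDissipation.AnomalousDissipation.Theorems.TaylorCertificatesFloorCertificateStubCylindricalCombination
import Mathlib.Analysis.Convex.Integral
import Mathlib.Analysis.Convex.Mul
import HarnessLib

/-!
# Stub `stub_eigenforceWorkBound` (S5a, "the Marchioro engine") of the line
# `dissipation-deficit-duality` (crux stmt-AnomalousDissipation-14091,
# `TaylorCertificates.FloorCertificate`)

THE ANTI-PUMPING WORK BOUND FOR STOKES-EIGENFIELD FORCING. Let `f` be a smooth, divergence-free,
mean-zero Stokes eigenfield on `T³`, `Δf = -λf` (`λ > 0`), and let `μ` be a *relaxed stationary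
statistic* of `NS_ν(f)`: a Borel probability measure on the energy space `H` carried by a ball,
with finite mean enstrophy, annihilating every cylindrical Liouville functional
`∫ ⟨F_ν(u), Φ'(u)⟩ dμ = 0` (FMRT 2001, Ch. IV (1.30)) and with integrable work `u ↦ (u, f)`. Then

  `‖f‖² + ∫ I_f(u) dμ(u) ≤ ‖f‖ (ν λ ε(μ))^{1/2}`,

where `I_f(u) = ∫ ⟪(∇f) u, u⟫ = Torus.inertialPairing u f` is the Reynolds stress against `f` and
`ε(μ) = ν ∫ ‖∇u‖² dμ = Torus.ensembleDissipation ν μ`.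

Proof.
* (W) *Work identity.* Testing the Liouville identity with the work functional `u ↦ (u, f)`
  (realised on the carrying ball by ONE cylindrical test functional with the single coordinate
  `g₀ = f` and a cut-off linear profile, `exists_cutoffProfile`) gives, since
  `⟨F_ν(u), f⟩ = ‖f‖² + ν (u, Δf) + I_f(u) = ‖f‖² - νλ (u, f) + I_f(u)`,
  the identity `‖f‖² + ∫ I_f dμ = νλ ∫ (u, f) dμ`.
* (P) *Poincaré in the direction of `f`.* In Fourier variables `f̂(k) = 0` unless `4π²|k|² = λ`
  (`Torus.mFourierCoeff_complexify_laplacian`), so by Parseval against the band-limited `f`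
  (`Torus.integral_inner_eq_sum_freqBall`) and Cauchy–Schwarz,
  `λ (u, f)² ≤ ‖f‖² · 4π² Σ |k|² ‖û(k)‖² ≤ ‖f‖² ‖∇u‖²` (`Torus.eGradNormSq_eq_tsum`).
* (J) *Jensen.* `∫ ‖∇u‖ dμ ≤ (∫ ‖∇u‖² dμ)^{1/2}` for the probability measure `μ`, whence
  `νλ ∫ (u, f) dμ ≤ ν λ^{1/2} ‖f‖ (ε(μ)/ν)^{1/2} = ‖f‖ (νλ ε(μ))^{1/2}`.

References: C. Foias, O. Manley, R. Rosa, R. Temam, *Navier–Stokes Equations and Turbulence*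
(CUP, 2001), Ch. IV §1.2 Def. 1.2–1.3, (1.28)–(1.31); C. Marchioro, *An example of absence of
turbulence for any Reynolds number*, Comm. Math. Phys. 105 (1986) 99–106.
-/

-- `Summit.<Summit>.<Problem>` is the tree's mandated summit-side namespace; for this
-- single-conjunct summit the two coincide, so the duplicate is deliberate.
set_option linter.dupNamespace false

noncomputable section

namespace Summit.AnomalousDissipation.AnomalousDissipation.Theorems.TaylorCertificatesFloorCertificate

open MeasureTheory Filter Topology UnitAddTorus
open scoped InnerProductSpace RealInnerProductSpace ENNReal NNReal
open Literature.Analysis.FunctionSpaces Literature.Analysis.FluidPDE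

/-! ## (W) The work functional as a cylindrical test functional -/

/-- **The work functional is cylindrical on every ball.** For a smooth, divergence-free, mean-zero
field `f` and a radius² `ρ` there is a cylindrical test functional `Φ` (one coordinate `g₀ = f`,
profile a cut-off of `z ↦ z₀`) with `Φ'(u) = f` at every `u ∈ H` with `|u|² ≤ ρ`. [folklore] -/
theorem eigenforce_exists_workTest (ρ : ℝ) {f : UnitAddTorus (Fin 3) → EuclideanSpace ℝ (Fin 3)}
    (hf : Torus.IsSmooth f) (hdiv : Torus.IsDivFree f) (hmean : Torus.HasZeroMean f) :
    ∃ Φ : Torus.CylindricalTest (Fin 3),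
      ∀ u : Torus.energySpace (Fin 3), ‖u‖ ^ 2 ≤ ρ → Φ.grad u = f := by
  obtain ⟨R, hR⟩ := exists_norm_coords_le (fun _ : Fin 1 => f) (fun _ => hf) ρ
  obtain ⟨φ₀, hφc, hφs, hφd⟩ := exists_cutoffProfile
    (ContinuousLinearMap.id ℝ (EuclideanSpace ℝ (Fin 1)))
    (ContinuousLinearMap.id ℝ (EuclideanSpace ℝ (Fin 1)))
    (φ₁ := fun z => EuclideanSpace.proj (𝕜 := ℝ) (0 : Fin 1) z)
    (φ₂ := fun z => EuclideanSpace.proj (𝕜 := ℝ) (0 : Fin 1) z)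
    (EuclideanSpace.proj (𝕜 := ℝ) (0 : Fin 1)).contDiff
    (EuclideanSpace.proj (𝕜 := ℝ) (0 : Fin 1)).contDiff 1 0 R
  refine ⟨⟨1, fun _ => f, fun _ => hf, fun _ => hdiv, fun _ => hmean, φ₀, hφc, hφs⟩,
    fun u hu => ?_⟩
  have hD := hφd (WithLp.toLp 2 fun _ : Fin 1 => Torus.pairing u.1 f) (hR u hu)
  simp only [ContinuousLinearMap.coe_id', id_eq, ContinuousLinearMap.fderiv,
    ContinuousLinearMap.comp_id, one_smul, zero_smul, add_zero] at hD
  funext x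
  simp only [Torus.CylindricalTest.grad, Torus.CylindricalTest.coords]
  rw [Fin.sum_univ_one, hD]
  simp

/-- The tested generator against the eigenfield itself:
`⟨F_ν(u), f⟩ = ‖f‖² + ν (−λ (u, f)) + I_f(u)` when `Δf = −λ f`. [folklore] -/
theorem eigenforce_nsGeneratorPairing_self (ν lam : ℝ)
    {f : UnitAddTorus (Fin 3) → EuclideanSpace ℝ (Fin 3)}
    (hΔ : ∀ x, Torus.laplacian f x = (-lam) • f x) (u : Torus.energySpace (Fin 3)) :
    Torus.nsGeneratorPairing ν f u f =
      (∫ x, ‖f x‖ ^ 2) + ν * (-lam * Torus.pairing u.1 f) + Torus.inertialPairing u.1 f := by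
  unfold Torus.nsGeneratorPairing Torus.pairing
  have h1 : (∫ x, ⟪f x, f x⟫_ℝ) = ∫ x, ‖f x‖ ^ 2 :=
    integral_congr_ae (ae_of_all _ fun x => real_inner_self_eq_norm_sq (f x))
  have h2 : (∫ x, ⟪(u.1 : UnitAddTorus (Fin 3) → EuclideanSpace ℝ (Fin 3)) x,
      Torus.laplacian f x⟫_ℝ) =
      -lam * ∫ x, ⟪(u.1 : UnitAddTorus (Fin 3) → EuclideanSpace ℝ (Fin 3)) x, f x⟫_ℝ := by
    rw [← integral_const_mul]
    refine integral_congr_ae (ae_of_all _ fun x => ?_)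
    dsimp only
    rw [hΔ x, real_inner_smul_right]
  rw [h1, h2]

/-! ## (P) Poincaré in the direction of a Stokes eigenfield -/

/-- Fourier coefficients of a real multiple: `𝓕(c v)(k) = c 𝓕(v)(k)`. [folklore] -/
theorem eigenforce_mFourierCoeff_complexify_smul (c : ℝ)
    (v : UnitAddTorus (Fin 3) → EuclideanSpace ℝ (Fin 3)) (k : Fin 3 → ℤ) :
    mFourierCoeff (EuclideanSpace.complexify ∘ fun x => c • v x) k =
      (c : ℂ) • mFourierCoeff (EuclideanSpace.complexify ∘ v) k := by
  rw [← Torus.mFourierCoeff_const_smul]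
  congr 1
  funext x
  simp only [Function.comp_apply, map_smul, Pi.smul_apply, Complex.coe_smul]

/-- **A Stokes eigenfield lives on one shell**: if `Δf = −λ f` (smooth `f`), then for every
frequency either `f̂(k) = 0` or `4π²|k|² = λ` (`𝓕(Δf)(k) = −4π²|k|² f̂(k)`, Grafakos 2014,
Prop. 3.2.6). [folklore] -/
theorem eigenforce_mFourierCoeff_eq_zero_or {lam : ℝ}
    {f : UnitAddTorus (Fin 3) → EuclideanSpace ℝ (Fin 3)} (hf : Torus.IsSmooth f)
    (hΔ : ∀ x, Torus.laplacian f x = (-lam) • f x) (k : Fin 3 → ℤ) :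
    mFourierCoeff (EuclideanSpace.complexify ∘ f) k = 0 ∨
      4 * Real.pi ^ 2 * Torus.freqNormSq k = lam := by
  have h1 := Torus.mFourierCoeff_complexify_laplacian hf k
  have h2 : Torus.laplacian f = fun x => (-lam) • f x := funext hΔ
  rw [h2, eigenforce_mFourierCoeff_complexify_smul, Complex.ofReal_neg, neg_smul, neg_inj] at h1
  have h3 : ((4 * Real.pi ^ 2 * Torus.freqNormSq k - lam : ℝ) : ℂ) •
      mFourierCoeff (EuclideanSpace.complexify ∘ f) k = 0 := by
    rw [Complex.ofReal_sub, sub_smul, h1, sub_self]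
  rcases smul_eq_zero.1 h3 with h | h
  · rw [Complex.ofReal_eq_zero, sub_eq_zero] at h
    exact Or.inr h
  · exact Or.inl h

/-- A Stokes eigenfield with `Δf = −λ f`, `λ > 0`, is band-limited to the frequency ball of radius
`⌈λ⌉₊`: `f̂(k) = 0` for `|k|² > ⌈λ⌉₊²` (as `4π²|k|² ≥ |k|² > ⌈λ⌉₊² ≥ ⌈λ⌉₊ ≥ λ`). [folklore] -/
theorem eigenforce_mFourierCoeff_eq_zero_of_lt {lam : ℝ}
    {f : UnitAddTorus (Fin 3) → EuclideanSpace ℝ (Fin 3)} (hf : Torus.IsSmooth f)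
    (hΔ : ∀ x, Torus.laplacian f x = (-lam) • f x) (k : Fin 3 → ℤ)
    (hk : ((⌈lam⌉₊ : ℕ) : ℝ) ^ 2 < Torus.freqNormSq k) :
    mFourierCoeff (EuclideanSpace.complexify ∘ f) k = 0 := by
  refine (eigenforce_mFourierCoeff_eq_zero_or hf hΔ k).resolve_right fun h => ?_
  have h1 : lam ≤ ((⌈lam⌉₊ : ℕ) : ℝ) := Nat.le_ceil lam
  have h2 : ((⌈lam⌉₊ : ℕ) : ℝ) ≤ ((⌈lam⌉₊ : ℕ) : ℝ) ^ 2 := by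
    have h' : (⌈lam⌉₊ : ℕ) ≤ (⌈lam⌉₊ : ℕ) ^ 2 := by
      rcases Nat.eq_zero_or_pos ⌈lam⌉₊ with h0 | h0
      · rw [h0]; norm_num
      · exact Nat.le_self_pow two_ne_zero _
    exact_mod_cast h'
  have h3 : Torus.freqNormSq k ≤ 4 * Real.pi ^ 2 * Torus.freqNormSq k := by
    have hpi : (1 : ℝ) ≤ 4 * Real.pi ^ 2 := by nlinarith [Real.pi_gt_three]
    nlinarith [Torus.freqNormSq_nonneg k]
  linarith

/-- A finite partial sum of the spectral enstrophy is bounded by the whole: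
`4π² Σ_{k∈S} |k|² ‖v̂(k)‖² ≤ ‖∇v‖²` when the latter is finite (`Torus.eGradNormSq_eq_tsum`).
[folklore] -/
theorem eigenforce_sum_freqNormSq_mul_norm_sq_le
    {v : UnitAddTorus (Fin 3) → EuclideanSpace ℝ (Fin 3)} (hv : Torus.eGradNormSq v ≠ ⊤)
    (S : Finset (Fin 3 → ℤ)) :
    ∑ k ∈ S, 4 * Real.pi ^ 2 * Torus.freqNormSq k *
        ‖mFourierCoeff (EuclideanSpace.complexify ∘ v) k‖ ^ 2 ≤ (Torus.eGradNormSq v).toReal := by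
  rw [← ENNReal.ofReal_le_iff_le_toReal hv, Torus.eGradNormSq_eq_tsum]
  have hsum : ∑ k ∈ S, 4 * Real.pi ^ 2 * Torus.freqNormSq k *
      ‖mFourierCoeff (EuclideanSpace.complexify ∘ v) k‖ ^ 2 =
      4 * Real.pi ^ 2 * ∑ k ∈ S, Torus.freqNormSq k *
        ‖mFourierCoeff (EuclideanSpace.complexify ∘ v) k‖ ^ 2 := by
    rw [Finset.mul_sum]
    exact Finset.sum_congr rfl fun k _ => by ring
  have h4 : (0 : ℝ) ≤ 4 * Real.pi ^ 2 := by positivity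
  have hS : ENNReal.ofReal (∑ k ∈ S, Torus.freqNormSq k *
      ‖mFourierCoeff (EuclideanSpace.complexify ∘ v) k‖ ^ 2) =
      ∑ k ∈ S, ENNReal.ofReal (Torus.freqNormSq k *
        ‖mFourierCoeff (EuclideanSpace.complexify ∘ v) k‖ ^ 2) :=
    ENNReal.ofReal_sum_of_nonneg fun k _ => mul_nonneg (Torus.freqNormSq_nonneg k) (sq_nonneg _)
  rw [hsum, ENNReal.ofReal_mul h4, hS]
  refine mul_le_mul_right ?_ _
  calc ∑ k ∈ S, ENNReal.ofReal (Torus.freqNormSq k *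
          ‖mFourierCoeff (EuclideanSpace.complexify ∘ v) k‖ ^ 2)
      = ∑ k ∈ S, ENNReal.ofReal (Torus.freqNormSq k) *
          ‖mFourierCoeff (EuclideanSpace.complexify ∘ v) k‖ₑ ^ 2 := by
        refine Finset.sum_congr rfl fun k _ => ?_
        rw [ENNReal.ofReal_mul (Torus.freqNormSq_nonneg k), ← ofReal_norm,
          ← ENNReal.ofReal_pow (norm_nonneg _)]
    _ ≤ ∑' k, ENNReal.ofReal (Torus.freqNormSq k) *
          ‖mFourierCoeff (EuclideanSpace.complexify ∘ v) k‖ₑ ^ 2 := ENNReal.sum_le_tsum S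

/-- **Poincaré in the direction of a Stokes eigenfield.** If `Δf = −λ f` with `λ > 0` (smooth
`f`) and `U ∈ L²` has finite spectral enstrophy, then
`λ^{1/2} |(U, f)| ≤ ‖∇U‖ ‖f‖`: in Fourier variables `(U, f) = Σ_{4π²|k|²=λ} Re ⟪Û(k), f̂(k)⟫`
(Parseval against the band-limited `f`), and Cauchy–Schwarz. [folklore] -/
theorem eigenforce_sqrt_mul_abs_integral_inner_le {lam : ℝ}
    {f U : UnitAddTorus (Fin 3) → EuclideanSpace ℝ (Fin 3)} (hf : Torus.IsSmooth f)
    (hΔ : ∀ x, Torus.laplacian f x = (-lam) • f x) (hU : MemLp U 2 volume)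
    (hfin : Torus.eGradNormSq U ≠ ⊤) :
    Real.sqrt lam * |∫ x, ⟪U x, f x⟫_ℝ| ≤
      Real.sqrt ((Torus.eGradNormSq U).toReal) * Real.sqrt (∫ x, ‖f x‖ ^ 2) := by
  have hf2 : MemLp f 2 volume := hf.memLp 2
  have hband : ∀ k, ((⌈lam⌉₊ : ℕ) : ℝ) ^ 2 < Torus.freqNormSq k →
      mFourierCoeff (EuclideanSpace.complexify ∘ f) k = 0 :=
    fun k hk => eigenforce_mFourierCoeff_eq_zero_of_lt hf hΔ k hk
  obtain ⟨A, hA⟩ : ∃ A : (Fin 3 → ℤ) → ℝ,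
      ∀ k, A k = ‖mFourierCoeff (EuclideanSpace.complexify ∘ U) k‖ := ⟨_, fun _ => rfl⟩
  obtain ⟨C, hC⟩ : ∃ C : (Fin 3 → ℤ) → ℝ,
      ∀ k, C k = ‖mFourierCoeff (EuclideanSpace.complexify ∘ f) k‖ := ⟨_, fun _ => rfl⟩
  have h2pi : Real.sqrt (4 * Real.pi ^ 2) = 2 * Real.pi := by
    rw [show (4 : ℝ) * Real.pi ^ 2 = (2 * Real.pi) ^ 2 by ring, Real.sqrt_sq (by positivity)]
  have hpair : (∫ x, ⟪U x, f x⟫_ℝ) = ∑ k ∈ Torus.freqBall ⌈lam⌉₊,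
      (inner ℂ (mFourierCoeff (EuclideanSpace.complexify ∘ U) k)
        (mFourierCoeff (EuclideanSpace.complexify ∘ f) k)).re :=
    Torus.integral_inner_eq_sum_freqBall hU hf2 hband
  have habs : |∫ x, ⟪U x, f x⟫_ℝ| ≤ ∑ k ∈ Torus.freqBall ⌈lam⌉₊, A k * C k := by
    rw [hpair]
    refine (Finset.abs_sum_le_sum_abs _ _).trans (Finset.sum_le_sum fun k _ => ?_)
    rw [hA, hC]
    exact (Complex.abs_re_le_norm _).trans (norm_inner_le_norm _ _)
  have hF : (∫ x, ‖f x‖ ^ 2) = ∑ k ∈ Torus.freqBall ⌈lam⌉₊, C k ^ 2 := by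
    rw [Torus.integral_norm_sq_eq_sum_of_band_limited hf.continuous hband]
    exact Finset.sum_congr rfl fun k _ => by rw [hC]
  have hterm : ∀ k, Real.sqrt lam * (A k * C k) =
      2 * Real.pi * Real.sqrt (Torus.freqNormSq k) * A k * C k := by
    intro k
    rcases eigenforce_mFourierCoeff_eq_zero_or hf hΔ k with h | h
    · rw [hC k, h, norm_zero, mul_zero, mul_zero, mul_zero]
    · rw [← h, Real.sqrt_mul' _ (Torus.freqNormSq_nonneg k), h2pi]
      ring
  have hGsum : ∑ k ∈ Torus.freqBall ⌈lam⌉₊, (2 * Real.pi * Real.sqrt (Torus.freqNormSq k) * A k) ^ 2 ≤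
      (Torus.eGradNormSq U).toReal := by
    calc ∑ k ∈ Torus.freqBall ⌈lam⌉₊, (2 * Real.pi * Real.sqrt (Torus.freqNormSq k) * A k) ^ 2
        = ∑ k ∈ Torus.freqBall ⌈lam⌉₊, 4 * Real.pi ^ 2 * Torus.freqNormSq k *
            ‖mFourierCoeff (EuclideanSpace.complexify ∘ U) k‖ ^ 2 := by
          refine Finset.sum_congr rfl fun k _ => ?_
          rw [hA, mul_pow, mul_pow, mul_pow, Real.sq_sqrt (Torus.freqNormSq_nonneg k)]
          ring
      _ ≤ (Torus.eGradNormSq U).toReal := eigenforce_sum_freqNormSq_mul_norm_sq_le hfin _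
  calc Real.sqrt lam * |∫ x, ⟪U x, f x⟫_ℝ|
      ≤ Real.sqrt lam * ∑ k ∈ Torus.freqBall ⌈lam⌉₊, A k * C k :=
        mul_le_mul_of_nonneg_left habs (Real.sqrt_nonneg _)
    _ = ∑ k ∈ Torus.freqBall ⌈lam⌉₊,
          (2 * Real.pi * Real.sqrt (Torus.freqNormSq k) * A k) * C k := by
        rw [Finset.mul_sum]
        exact Finset.sum_congr rfl fun k _ => by rw [hterm k]
    _ ≤ Real.sqrt (∑ k ∈ Torus.freqBall ⌈lam⌉₊,
            (2 * Real.pi * Real.sqrt (Torus.freqNormSq k) * A k) ^ 2) *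
          Real.sqrt (∑ k ∈ Torus.freqBall ⌈lam⌉₊, C k ^ 2) :=
        Real.sum_mul_le_sqrt_mul_sqrt _ (fun k => 2 * Real.pi * Real.sqrt (Torus.freqNormSq k) * A k) C
    _ ≤ Real.sqrt ((Torus.eGradNormSq U).toReal) * Real.sqrt (∫ x, ‖f x‖ ^ 2) := by
        rw [← hF]
        exact mul_le_mul_of_nonneg_right (Real.sqrt_le_sqrt hGsum) (Real.sqrt_nonneg _)

/-! ## (J) Jensen for the square root -/

/-- **Jensen for the square root**: `∫ √g dμ ≤ √(∫ g dμ)` for a probability measure `μ` and a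
nonnegative integrable `g` (convexity of the square). [folklore] -/
theorem eigenforce_integral_sqrt_le {α : Type*} [MeasurableSpace α] {μ : Measure α}
    [IsProbabilityMeasure μ] {g : α → ℝ} (hg : Integrable g μ) (hnn : ∀ x, 0 ≤ g x) :
    ∫ x, Real.sqrt (g x) ∂μ ≤ Real.sqrt (∫ x, g x ∂μ) := by
  have hsi : Integrable (fun x => Real.sqrt (g x)) μ := by
    refine Integrable.mono' ((integrable_const (1 : ℝ)).add hg)
      (Real.continuous_sqrt.comp_aestronglyMeasurable hg.aestronglyMeasurable)
      (ae_of_all _ fun x => ?_)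
    rw [Real.norm_eq_abs, abs_of_nonneg (Real.sqrt_nonneg _), Pi.add_apply,
      Real.sqrt_le_left (by linarith [hnn x])]
    nlinarith [hnn x]
  refine (Real.le_sqrt (integral_nonneg fun x => Real.sqrt_nonneg _)
    (integral_nonneg hnn)).2 ?_
  have hsq : Integrable ((fun y : ℝ => y ^ 2) ∘ fun x => Real.sqrt (g x)) μ :=
    hg.congr (ae_of_all _ fun x => by
      simp only [Function.comp_apply, Real.sq_sqrt (hnn x)])
  have hJ := (Even.convexOn_pow (𝕜 := ℝ) even_two).map_integral_le
    (continuous_pow 2).continuousOn isClosed_univ (ae_of_all _ fun x => Set.mem_univ _) hsi hsq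
  refine hJ.trans_eq (integral_congr_ae (ae_of_all _ fun x => ?_))
  exact Real.sq_sqrt (hnn x)

/-! ## The stub -/

/-- **S5a `stub_eigenforceWorkBound` (the Marchioro engine)** — ANTI-PUMPING WORK BOUND FOR
STOKES-EIGENFIELD FORCING. For a smooth, divergence-free, mean-zero `f` with `Δf = −λf`
(`ν, λ > 0`) and a relaxed stationary statistic `μ` of `NS_ν(f)` (probability measure on `H`
carried by a ball, finite mean enstrophy, annihilating every cylindrical Liouville functional,
integrable work), `‖f‖² + ∫ I_f dμ ≤ ‖f‖ (νλ ε(μ))^{1/2}`. Proof: the work identity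
`‖f‖² + ∫ I_f dμ = νλ ∫ (u, f) dμ` (Liouville identity tested with the cylindrical work
functional `eigenforce_exists_workTest`), Poincaré in the direction of `f`
(`eigenforce_sqrt_mul_abs_integral_inner_le`) and Jensen (`eigenforce_integral_sqrt_le`).
[cite: FMRTTurbulence2001, Ch. IV §1.2 Def. 1.3, (1.28)–(1.31) (stationary statistical
solutions and the Liouville equation ∫ ⟨F(u), Φ'(u)⟩ dμ = 0)] -/
theorem stub_eigenforceWorkBound :
    ∀ (ν lam ρ : ℝ) (f : UnitAddTorus (Fin 3) → EuclideanSpace ℝ (Fin 3)),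
      0 < ν → 0 < lam → Torus.IsSmooth f → Torus.IsDivFree f → Torus.HasZeroMean f →
      (∀ x, Torus.laplacian f x = (-lam) • f x) →
      ∀ μ : Measure (Torus.energySpace (Fin 3)),
        IsProbabilityMeasure μ →
        (∀ᵐ u ∂μ, ‖u‖ ^ 2 ≤ ρ) →
        Torus.ensembleEnstrophy μ < ⊤ →
        (∀ Φ : Torus.CylindricalTest (Fin 3),
          Integrable (fun u => Torus.nsGeneratorPairing ν f u (Φ.grad u)) μ ∧
            ∫ u, Torus.nsGeneratorPairing ν f u (Φ.grad u) ∂μ = 0) →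
        Integrable (fun u : Torus.energySpace (Fin 3) => Torus.pairing u.1 f) μ →
        (∫ x, ‖f x‖ ^ 2) + ∫ u, Torus.inertialPairing u.1 f ∂μ ≤
          Real.sqrt ((∫ x, ‖f x‖ ^ 2) * (ν * lam * Torus.ensembleDissipation ν μ)) := by
  intro ν lam ρ f hν hlam hf hdiv hmean hΔ μ hμ hball hens hL hwork
  set F2 : ℝ := ∫ x, ‖f x‖ ^ 2
  have hF2nn : 0 ≤ F2 := integral_nonneg fun x => by positivity
  -- (W) the work identity
  obtain ⟨Φ, hΦ⟩ := eigenforce_exists_workTest ρ hf hdiv hmean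
  obtain ⟨hint, hzero⟩ := hL Φ
  have hae : (fun u => Torus.nsGeneratorPairing ν f u (Φ.grad u)) =ᵐ[μ] fun u =>
      (F2 + ν * (-lam * Torus.pairing u.1 f)) + Torus.inertialPairing u.1 f := by
    filter_upwards [hball] with u hu
    rw [hΦ u hu, eigenforce_nsGeneratorPairing_self ν lam hΔ u]
  have hlin : Integrable (fun u : Torus.energySpace (Fin 3) =>
      F2 + ν * (-lam * Torus.pairing u.1 f)) μ :=
    (integrable_const F2).add ((hwork.const_mul (-lam)).const_mul ν)
  have hI : Integrable (fun u : Torus.energySpace (Fin 3) => Torus.inertialPairing u.1 f) μ := by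
    have h := (hint.congr hae).sub hlin
    refine h.congr (ae_of_all _ fun u => ?_)
    simp only [Pi.sub_apply, add_sub_cancel_left]
  have hstar : F2 + ∫ u, Torus.inertialPairing u.1 f ∂μ =
      ν * lam * ∫ u, Torus.pairing u.1 f ∂μ := by
    have h1 : ∫ u, Torus.nsGeneratorPairing ν f u (Φ.grad u) ∂μ =
        (∫ u, (F2 + ν * (-lam * Torus.pairing u.1 f)) ∂μ) +
          ∫ u, Torus.inertialPairing u.1 f ∂μ := by
      rw [integral_congr_ae hae, integral_add hlin hI]
    have h2 : ∫ u, (F2 + ν * (-lam * Torus.pairing u.1 f)) ∂μ =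
        F2 + ν * (-lam * ∫ u, Torus.pairing u.1 f ∂μ) := by
      rw [integral_add (integrable_const F2) ((hwork.const_mul (-lam)).const_mul ν),
        integral_const, probReal_univ, one_smul, integral_const_mul, integral_const_mul]
    rw [hzero, h2] at h1
    linarith
  -- (J) the enstrophy density and its square root
  have hGm : Measurable fun u : Torus.energySpace (Fin 3) =>
      Torus.eGradNormSq (u.1 : UnitAddTorus (Fin 3) → EuclideanSpace ℝ (Fin 3)) :=
    Torus.measurable_eGradNormSq_coe
  have hens' :
      ∫⁻ u, Torus.eGradNormSq (u.1 : UnitAddTorus (Fin 3) → EuclideanSpace ℝ (Fin 3)) ∂μ ≠ ⊤ := hens.ne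
  have hfin_ae : ∀ᵐ u ∂μ,
      Torus.eGradNormSq (u.1 : UnitAddTorus (Fin 3) → EuclideanSpace ℝ (Fin 3)) < ⊤ :=
    ae_lt_top hGm hens'
  have hGint : Integrable (fun u : Torus.energySpace (Fin 3) =>
      (Torus.eGradNormSq (u.1 : UnitAddTorus (Fin 3) → EuclideanSpace ℝ (Fin 3))).toReal) μ :=
    integrable_toReal_of_lintegral_ne_top hGm.aemeasurable hens'
  have hGE : ∫ u, (Torus.eGradNormSq
      (u.1 : UnitAddTorus (Fin 3) → EuclideanSpace ℝ (Fin 3))).toReal ∂μ =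
      (Torus.ensembleEnstrophy μ).toReal :=
    integral_toReal hGm.aemeasurable hfin_ae
  have hP : ∀ᵐ u ∂μ, Real.sqrt lam * |Torus.pairing u.1 f| ≤
      Real.sqrt ((Torus.eGradNormSq
        (u.1 : UnitAddTorus (Fin 3) → EuclideanSpace ℝ (Fin 3))).toReal) * Real.sqrt F2 :=
    hfin_ae.mono fun u hu =>
      eigenforce_sqrt_mul_abs_integral_inner_le hf hΔ (Lp.memLp _) hu.ne
  have hsqi : Integrable (fun u : Torus.energySpace (Fin 3) => Real.sqrt ((Torus.eGradNormSq
      (u.1 : UnitAddTorus (Fin 3) → EuclideanSpace ℝ (Fin 3))).toReal)) μ := by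
    refine Integrable.mono' ((integrable_const (1 : ℝ)).add hGint)
      (Real.continuous_sqrt.comp_aestronglyMeasurable hGint.aestronglyMeasurable)
      (ae_of_all _ fun u => ?_)
    rw [Real.norm_eq_abs, abs_of_nonneg (Real.sqrt_nonneg _), Pi.add_apply,
      Real.sqrt_le_left (by positivity)]
    nlinarith [(ENNReal.toReal_nonneg : 0 ≤ (Torus.eGradNormSq
      (u.1 : UnitAddTorus (Fin 3) → EuclideanSpace ℝ (Fin 3))).toReal)]
  have hJ : ∫ u, Real.sqrt ((Torus.eGradNormSq
      (u.1 : UnitAddTorus (Fin 3) → EuclideanSpace ℝ (Fin 3))).toReal) ∂μ ≤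
      Real.sqrt ((Torus.ensembleEnstrophy μ).toReal) := by
    rw [← hGE]
    exact eigenforce_integral_sqrt_le hGint fun u => ENNReal.toReal_nonneg
  have h1 : Real.sqrt lam * ∫ u, |Torus.pairing u.1 f| ∂μ ≤
      Real.sqrt F2 * Real.sqrt ((Torus.ensembleEnstrophy μ).toReal) := by
    rw [← integral_const_mul]
    calc ∫ u, Real.sqrt lam * |Torus.pairing u.1 f| ∂μ
        ≤ ∫ u, Real.sqrt ((Torus.eGradNormSq
            (u.1 : UnitAddTorus (Fin 3) → EuclideanSpace ℝ (Fin 3))).toReal) * Real.sqrt F2 ∂μ :=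
          integral_mono_ae (hwork.abs.const_mul _) (hsqi.mul_const _) hP
      _ = (∫ u, Real.sqrt ((Torus.eGradNormSq
            (u.1 : UnitAddTorus (Fin 3) → EuclideanSpace ℝ (Fin 3))).toReal) ∂μ) * Real.sqrt F2 :=
          integral_mul_const _ _
      _ ≤ Real.sqrt ((Torus.ensembleEnstrophy μ).toReal) * Real.sqrt F2 :=
          mul_le_mul_of_nonneg_right hJ (Real.sqrt_nonneg _)
      _ = Real.sqrt F2 * Real.sqrt ((Torus.ensembleEnstrophy μ).toReal) := mul_comm _ _
  have h2 : ∫ u, Torus.pairing u.1 f ∂μ ≤ ∫ u, |Torus.pairing u.1 f| ∂μ :=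
    integral_mono hwork hwork.abs fun u => le_abs_self _
  have hrhs : Real.sqrt (F2 * (ν * lam * Torus.ensembleDissipation ν μ)) =
      ν * Real.sqrt lam * (Real.sqrt F2 * Real.sqrt ((Torus.ensembleEnstrophy μ).toReal)) := by
    have h : F2 * (ν * lam * Torus.ensembleDissipation ν μ) =
        (ν * Real.sqrt lam * (Real.sqrt F2 * Real.sqrt ((Torus.ensembleEnstrophy μ).toReal))) ^ 2 := by
      unfold Torus.ensembleDissipation
      rw [mul_pow, mul_pow, mul_pow, Real.sq_sqrt hlam.le, Real.sq_sqrt hF2nn, Real.sq_sqrt ENNReal.toReal_nonneg]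
      ring
    rw [h, Real.sqrt_sq (by positivity)]
  have hsq : Real.sqrt lam * Real.sqrt lam = lam := Real.mul_self_sqrt hlam.le
  calc F2 + ∫ u, Torus.inertialPairing u.1 f ∂μ
      = ν * lam * ∫ u, Torus.pairing u.1 f ∂μ := hstar
    _ = ν * Real.sqrt lam * (Real.sqrt lam * ∫ u, Torus.pairing u.1 f ∂μ) := by
        rw [← mul_assoc, mul_assoc ν (Real.sqrt lam) (Real.sqrt lam), hsq]
    _ ≤ ν * Real.sqrt lam * (Real.sqrt lam * ∫ u, |Torus.pairing u.1 f| ∂μ) :=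
        mul_le_mul_of_nonneg_left (mul_le_mul_of_nonneg_left h2 (Real.sqrt_nonneg _))
          (by positivity)
    _ ≤ ν * Real.sqrt lam * (Real.sqrt F2 * Real.sqrt ((Torus.ensembleEnstrophy μ).toReal)) :=
        mul_le_mul_of_nonneg_left h1 (by positivity)
    _ = Real.sqrt (F2 * (ν * lam * Torus.ensembleDissipation ν μ)) := hrhs.symm

end Summit.AnomalousDissipation.AnomalousDissipation.Theorems.TaylorCertificatesFloorCertificate
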